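import Literature.AlgebraicGeometry.HodgeTheory.TimesGluedBlocksInvariance
import Literature.AlgebraicGeometry.HodgeTheory.TimesLowGenericProductSpan
import Literature.AlgebraicGeometry.HodgeTheory.TimesNonCMCurveProductSpan
import Literature.AlgebraicGeometry.HodgeTheory.TotallyRealMaxSubfieldPowersHodgeClasses
import Literature.AlgebraicGeometry.HodgeTheory.QuaternionMinimalPowersHodgeClasses
import Literature.AlgebraicGeometry.HodgeTheory.TypeIIMinimalPowersHodgeClasses
import Literature.AlgebraicGeometry.HodgeTheory.SimpleSurfaceTimesCMCurveStablyNondegenerate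
import Literature.AlgebraicGeometry.Motives.HodgeThetaAnnihilatorSymplecticTimesAnisotropic
import HarnessLib

/-!
# `HodgeClassesProductSpan (A^{N+1}) (S^{N+1})` and condition (D) for `A × S`, `S` with real multiplication of relative dimension one or quaternionic multiplication of minimal dimension and `Hom(A, S) = 0` (Moonen–Zarhin 1999 Lemma (3.4) with (2.2) and (3.1)); every `Y × S` with `dim Y ≤ 3` and `S` a simple abelian surface not of CM type satisfies (D) (Thm. 0.1 (4), Thm. 0.2 (4))

Family `hodge`, layer `Literature/AlgebraicGeometry/HodgeTheory`. Research context: cell `pub-hodge-ring2`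
(HONEST FRAMING: research route conditional on HC_CM; not a corollary; Q11.4-sentence-2 already refuted in
dim ≥ 3), Literature lane, programme R25 («`X × S` for `S` a simple abelian surface with real multiplication by a
real quadratic field (type I(2)) or with quaternionic multiplication (type II(1)), and ANY `X` with
`Hom(X, S) = 0`» — the last non-simple fourfold rows `S' × S` of Moonen–Zarhin's Thm. 0.1 (4) outside case (a)
that the tree lacked). UNCONDITIONAL; theorems only, no definition, no named fact; no step towards a summit
statement beyond the published theorems it formalizes. This file is the COMPANION of `TimesLowGenericProductSpan`
(programme R23, `End⁰(S) = ℚ`, `dim S ≤ 3`), fed by the invariance theorem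
`AVSlots.exists_coeff_eq_zero_off_balanced_of_prod_gluedBlocks` (`TimesGluedBlocksInvariance`) whose glued-block
hypotheses (GLUED), (BLOCKS), (QS) on `H¹(S) ⊗ ℂ` are DISCHARGED here for
(I) every `S` of Murty type with `m = 1` — a totally real number field `K`, `φ : K →+* End⁰(S)` its own commutant,
`dim S = [K:ℚ]` (`IsMurtyTypeWith S K φ 1`; the simple abelian surfaces of type I(2)) — by the tree's bridge
`exists_glued_adapted_blockBasis_of_isMurtyTypeWith_one` on the joint eigenspaces `V_κ` of `K`, and
(II) every SIMPLE `S` with a real splitting `ℝ ⊗ End⁰(S) ≃ ∏_ι M₂(ℝ)`, `dim S = 2|ι|` — in particular `End⁰(S)`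
a quaternion algebra over a totally real `K` with `dim S = 2[K:ℚ]` (the simple abelian surfaces of type II(1)) —
by the tree's bridge `exists_glued_adapted_blockBasis_of_realSplitting` on the matrix-unit blocks.

PRINTED RESULTS. B. Moonen, Yu. G. Zarhin, *Hodge classes on abelian varieties of low dimension*, Math. Ann.
**315** (1999) 711–733 [corpus: paper:arxiv-math_9901113]. §3 (3.1) [chunk p0006 L52–L62]: `Hg(X₁ × X₂) = Hg(X₁) × Hg(X₂)`
fails «if and only if for some `m` and `n` the Hodge ring `B(X₁^m × X₂^n)` is not generated by the elements
coming from `B(X₁^m)` and `B(X₂^n)`»; Lemma (3.4) [chunk p0006 L133–L138, proof through p0007 L8]: «Let `X₁` and `X₂` be nonzero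
complex abelian varieties. Write `X = X₁ × X₂`. Assume that `hg(X₂)` is a `ℚ`-simple Lie algebra of non-compact
type and that, up to isomorphism, `V_{X₂}` is the only irreducible `hg(X₂)`-module which is a length 1
representation of non-compact type. Then either `Hg(X) = Hg(X₁) × Hg(X₂)` or `Hom(X₂, X₁) ≠ 0`»; (2.2) [chunk
p0005 L62–L73]: Type 1(2) «`End⁰(X) = F` is a real quadratic field. … The Hodge group is given by
`Hg(X) = Res_{F/ℚ} Sp_F(V,ψ)`» (`= R_{F/ℚ} SL_{2,F}`, `V` being a plane over `F`), Type 2(1) «`D = End⁰(X)` is a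
quaternion algebra over `ℚ`, split at `∞`. … Then `Hg(X)` is the algebraic group `U_{D^opp}`»; (2.4)(3) [chunk
p0005 L118–L124]: «If `Hg(X)` is `ℚ`-simple then (up to isomorphism)
there is exactly one faithful irreducible representation of `hg(X)` over `ℚ` which is of length 1»; (5.4) [chunk p0009 L93]:
«If `dim(X₂) < 3` then the desired equality `Hg(X) = Hg(X₁) × Hg(X₂)` follows from (2.4) and (3.4)»; §5 (5.2)
[chunk p0008]: «If we are not in case (a) then, using the Theorem (3.2) of Hazama and Murty and the results discussed in
§2, we see that in order to prove (0.1) for `X` it suffices to show that `Hg(X) = Hg(Y_1^{m_1}) × ⋯ ×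
Hg(Y_r^{m_r})`»; Thm. 0.1 (4) [chunk p0001 L120–L121] (`dim X ≤ 4`: (D) outside the cases (a)–(d)) and Thm. 0.2 (4)
[chunk p0002 L1–L7] (`dim X = 5`, no simple factor of dimension `4`, outside (e)–(g)). None of the exceptional cases
(a)–(g) has an isogeny factor `S` which is a simple abelian surface not of CM type times a cofactor of dimension
`≤ 3` with `Hom = 0` [chunk p0001 L77–L92, L129–L140]. F. Hazama, Tôhoku Math. J. **35** (1983) §3 and V. K. Murty,
Proc. AMS **104** (1988) Thm. 2: the Lie algebras of these `S` (the tree's bridges).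

MAIN RESULTS (all proved):
* §1 `hodgeClassesProductSpan_of_avSlots_of_gluedBlocks`: for `B` with `n` slots over `A` and `Z` with `n` slots
  over `S`, `S` with glued-block data and no non-zero morphism of Hodge structures `H¹(S) → H¹(A)`, every rational
  `(p,p)`-class on `B × Z` is a `ℂ`-combination of exterior products of RATIONAL HODGE classes; §2
  `IsStablyNondegenerate.prod_gluedBlocks_of_forall_hom_eq_zero`: (D) for `A`, (D) for `S`, `Hom(A, S) = 0` ⟹ (D)
  for `A × S`;
* §3 (QS) for a number field acting on `H¹`: a non-zero rational operator is non-zero on every joint eigenspace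
  `V_κ` (`exists_mem_jointEigenspace_baseChange_ne_zero`) — `∏_{κ' ≠ κ} (α_ℂ − κ'(α))` for a primitive element
  `α` kills the other `V_κ'`, and `ℚ`-independent operators stay `ℂ`-independent;
* §4 THE MURTY ROW `IsStablyNondegenerate.prod_isMurtyTypeWith_one_of_forall_hom_eq_zero`: `A` (D),
  `IsMurtyTypeWith S K φ 1`, `Hom(A, S) = 0` ⟹ `A × S` (D) (and the product span on all `A^{N+1} × S^{N+1}`);
* §5 THE QUATERNION ROW `IsStablyNondegenerate.prod_isSimple_quaternion_of_dim_eq_of_forall_hom_eq_zero`: `A` (D),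
  `S` simple with `End⁰(S)` a quaternion algebra over a totally real `K`, `dim S = 2[K:ℚ]`, `Hom(A, S) = 0` ⟹
  `A × S` (D) (through the real-splitting form `…_of_realSplitting_…`);
* §6 SURFACES: `IsStablyNondegenerate.prod_simpleSurface_of_not_isOfCMType_of_forall_hom_eq_zero` (`A` (D), `S`
  a simple abelian surface NOT of CM type — types I(1), I(2), II(1) —, `Hom(A, S) = 0`); and with NO `Hom`
  hypothesis (Poincaré case analyses as in the companion): `isStablyNondegenerate_prod_simpleSurface_of_dim_le_two`
  (`Y × S`, `0 < dim Y ≤ 2`: the FOURFOLD rows `S' × S` of Thm. 0.1 (4) for all abelian surfaces `S'`),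
  `isStablyNondegenerate_threefold_prod_simpleSurface` (`T × S`, `dim T = 3`: FIVEFOLDS, Thm. 0.2 (4)),
  `isStablyNondegenerate_prod_simpleSurface_of_dim_le_three` and the Hodge conjecture for all these products,
  everything isogenous to them and all their powers — UNCONDITIONALLY.

PROOF. §1–§2 = the companion's §1–§2 verbatim, fed by the new invariance theorem. §3: if `Y_ℂ` vanished on
`V_{κ₀}`, then `Y_ℂ ∘ P(α_ℂ) = 0` for `P = ∏_{κ ≠ κ₀} (X − κ(α))` (`α` a primitive element: `P(α_ℂ)` kills the
other `V_κ` and is a scalar on `V_{κ₀}`), a non-trivial `ℂ`-relation (leading coefficient `1`) among the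
`(Y α^j)_ℂ`, `j < [K:ℚ]`, which are `ℚ`-independent (`Y ≠ 0` and `y ↦ Y ∘ y^*` is injective on the field `K`)
hence `ℂ`-independent (`finrank_spanC_eq`). §4: blocks `V_κ` (`isInternal_jointEigenspace`,
`mapsTo_jointEigenspace_of_forall_commute`), glued data `exists_glued_adapted_blockBasis_of_isMurtyTypeWith_one`,
(QS) §3, (D) for `S` `isDivisorGenerated_powSucc_of_isMurtyTypeWith_one`. §5: blocks `RealSplitting.block`
(`isInternal_block`, `mapsTo_block_of_forall_commute`), glued data `exists_glued_adapted_blockBasis_of_realSplitting`,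
(QS): a non-zero rational operator commuting with `End⁰(S)` (a division algebra of dimension `dim_ℚ H¹`) is
invertible (`AntiRep.eq_zero_or_isUnit_of_forall_commute`) and the blocks are two-dimensional
(`RealSplitting.finrank_block`); the Albert form through `isTotallyIndefinite_of_isSimple_of_dim_eq`,
`nonempty_realSplitting_of_isSimple_isTotallyIndefinite`; (D) for `S`
`isDivisorGenerated_powSucc_of_isSimple_quaternion_of_dim_eq`. §6: `dim_ℚ End⁰(S) ∈ {1, 2, 4}`
(`finrank_endAlgebra_eq_of_isSimple_surface`): `1` the companion's row, `2` a real quadratic field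
(`isTotallyReal_endField_of_surface`, the Murty packet `isMurtyTypeWith_endField` with `r = 1`), `4` commutative is
CM type (`isOfCMType_of_isSimple_surface_of_comm_of_finrank_eq_four`, excluded), `4` non-commutative a quaternion
algebra over `ℚ` (`isQuaternionAlgebra_endAlgebra_of_isSimple`); the `Hom`-free rows as in the companion, the shape
`T ∼ E' × S` giving `S × S × E'` ((D) by the companion's curve row for `E'` without CM, by the R5 row
`prod_cmCurve_of_hasNoTypeIVFactor` for `E'` with CM, `S` having no factor of Type IV:
`hasNoTypeIVFactor_of_isSimple_surface_of_not_isOfCMType`).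

## References

* [MoonenZarhin1999LowDim] B. Moonen, Yu. Zarhin, Math. Ann. 315 (1999), Thm. 0.1, Thm. 0.2, §2 (2.2), (2.4),
  §3 (3.1), Thm. (3.2), Lemma (3.4), §5 (5.2), (5.4). [cite: MoonenZarhin1999LowDim, §3 Lemma (3.4)]
* [Murty1988] V. Kumar Murty, Proc. AMS 104 (1988), Thm. 2 (p. 67). [cite: Murty1988, Thm. 2 (p. 67)]
* [Hazama1983] F. Hazama, Tôhoku Math. J. 35 (1983), §3 pp. 305–306. [cite: Hazama1983, §3 (pp. 305–306)]
* [BanaszakGajdaKrason2006] G. Banaszak, W. Gajda, P. Krasoń, Tôhoku Math. J. 58 (2006), p. 36, (7.22), Thm. 7.34.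
  [cite: BanaszakGajdaKrason2006, Thm. 7.34]
* [Gordon1999HodgeAVSurvey] B. B. Gordon, *A survey of the Hodge conjecture for abelian varieties*, Thm. 7.5,
  Def. 7.6. [cite: Gordon1999HodgeAVSurvey, Def. 7.6]
* [vanGeemen1994HodgeAV] B. van Geemen, LNM 1594 (1994), §2.4, §3.6–3.7, Thm. 4.3. [cite: vanGeemen1994HodgeAV, §3.6 (p. 236)]
* [DeligneMilne1982Tannakian] P. Deligne, J. S. Milne, LNM 900 (1982), §6 Thm. 6.20. [cite: DeligneMilne1982Tannakian, §6 Thm. 6.20]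
* [Deligne1982HodgeCycles] P. Deligne, LNM 900 (1982), §4 p. 30; I §3 Prop. 3.4. [cite: Deligne1982HodgeCycles, §4 p. 30]
* [MumfordAV1970] D. Mumford, *Abelian Varieties* (1970), §19 Thm. 1 and Cor. 2 (pp. 173–174), §21.
  [cite: MumfordAV1970, §19 Thm. 1 (pp. 173–174)]
* [VoisinHodgeI2002] C. Voisin, *Hodge Theory I*, §11.3.2 Thm. 11.38. [cite: VoisinHodgeI2002, §11.3.2 Thm. 11.38]
-/

noncomputable section

open scoped TensorProduct
open CategoryTheory CategoryTheory.Limits Module MonoidalCategory CartesianMonoidalCategory NumberField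

namespace Literature.AlgebraicGeometry.HodgeTheory

open Literature.AlgebraicTopology.SingularHomology
open Literature.AlgebraicGeometry.Motives (IsSmoothProjective AbelianVariety bettiCohomology
  ofRatClassBaseChange ComplexPoints HodgeTensorFacts hodgeTensorFacts_holds)
open Literature.AlgebraicGeometry.Motives.AbelianVariety
open Literature.AlgebraicGeometry.Milne1999 (IsOfCMType)
open Literature.AlgebraicGeometry.Motives.HodgeStructure
open Literature.AlgebraicGeometry.ComplexMultiplication
open Literature.NumberTheory.DiophantineGeometry
open Literature.Barriers.HodgeConjecture
open Literature.RepresentationTheory.GeneralLinear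
open Literature.RingTheory.CentralSimple
open Literature.NumberTheory.Automorphic (IsQuaternionAlgebra)

/-! ### §1 `HodgeClassesProductSpan B Z` for slots over `A` and over `S`, `S` with glued blocks, `Hom_Hdg = 0` -/

section ProductSpan

variable {A B S Z : AbelianVariety ℂ} {n : ℕ} {gB : Fin n → (B ⟶ A)} {gS : Fin n → (Z ⟶ S)}

variable {κ : Type} [Fintype κ] [DecidableEq κ] [Nonempty κ] {T : κ → Submodule ℂ (ℂ ⊗[ℚ] bettiCohomology S.X 1)}
  (hint : DirectSum.IsInternal T)
  (hTE : ∀ (hHD : exists_isReal_hodgeModel) (hI : hodgePQ_independent_of_hodgeModel)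
    (Y : Module.End ℚ (bettiCohomology S.X 1)),
    (∀ a : (BettiUniverse.hodge hHD (AbelianVariety.isSmoothProjective_holds (A := S)) 1).endAlg,
      Y * (a : Module.End ℚ (bettiCohomology S.X 1)) = (a : Module.End ℚ (bettiCohomology S.X 1)) * Y) →
    ∀ k, Set.MapsTo (Y.baseChange ℂ) (T k) (T k))
  (hS : ∀ (hHD : exists_isReal_hodgeModel) (hI : hodgePQ_independent_of_hodgeModel)
    (ψ : (BettiUniverse.hodge hHD (AbelianVariety.isSmoothProjective_holds (A := S)) 1).Polarization)
    {Θ : Module.End ℂ (ℂ ⊗[ℚ] bettiCohomology S.X 1)},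
    (∀ p, ∀ x ∈ (BettiUniverse.hodge hHD (AbelianVariety.isSmoothProjective_holds (A := S)) 1).piece p
      (((1 : ℕ) : ℤ) - p), Θ x = ((2 * p - ((1 : ℕ) : ℤ) : ℤ) : ℂ) • x) →
    ∃ (cls : κ → κ) (b' : ∀ k, Module.Basis (Fin 2) ℂ (T k)),
      (∀ k, (b' k 0 : ℂ ⊗[ℚ] bettiCohomology S.X 1) ∈
        (BettiUniverse.hodge hHD (AbelianVariety.isSmoothProjective_holds (A := S)) 1).piece 1 0) ∧
      (∀ k, (b' k 1 : ℂ ⊗[ℚ] bettiCohomology S.X 1) ∈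
        (BettiUniverse.hodge hHD (AbelianVariety.isSmoothProjective_holds (A := S)) 1).piece 0 1) ∧
      (∀ k, cls (cls k) = cls k) ∧
      ∀ 𝔤 : Submodule ℚ (Module.End ℚ (bettiCohomology S.X 1)),
        (∀ Y ∈ 𝔤, ∀ Y' ∈ 𝔤, Y * Y' - Y' * Y ∈ 𝔤) → Θ ∈ spanC 𝔤 →
        (∀ Y ∈ 𝔤, ∀ a : (BettiUniverse.hodge hHD (AbelianVariety.isSmoothProjective_holds (A := S)) 1).endAlg,
          Y * (a : Module.End ℚ (bettiCohomology S.X 1)) = (a : Module.End ℚ (bettiCohomology S.X 1)) * Y) →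
        (∀ Y ∈ 𝔤, ∀ v w, ψ.form (Y v) w + ψ.form v (Y w) = 0) →
        (∀ Y ∈ spanC 𝔤, ∀ k, (RealPlaces.blockMat hint b' Y k).trace = 0) ∧
        (∀ Y ∈ spanC 𝔤, ∀ k k', cls k = cls k' → RealPlaces.blockMat hint b' Y k = RealPlaces.blockMat hint b' Y k') ∧
        (∀ (k₀ : κ) (N : Matrix (Fin 2) (Fin 2) ℂ), N.trace = 0 →
          RealPlaces.assemble hint b' (fun k => if cls k = cls k₀ then N else 0) ∈ spanC 𝔤))
  (hqs : ∀ (hHD : exists_isReal_hodgeModel) (hI : hodgePQ_independent_of_hodgeModel)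
    (Y : Module.End ℚ (bettiCohomology S.X 1)),
    (∀ a : (BettiUniverse.hodge hHD (AbelianVariety.isSmoothProjective_holds (A := S)) 1).endAlg,
      Y * (a : Module.End ℚ (bettiCohomology S.X 1)) = (a : Module.End ℚ (bettiCohomology S.X 1)) * Y) →
    Y ≠ 0 → ∀ k, ∃ x ∈ T k, Y.baseChange ℂ x ≠ 0)

include hint hTE hS hqs

/-- **`HodgeClassesProductSpan B Z` (Moonen–Zarhin Lemma (3.4) with (2.2) and (3.1) for «anything × (`S` with
glued `𝔰𝔩₂`-blocks), `Hom = 0`», PROVED with slots).** Let `H¹(S) ⊗ ℂ = ⊕_k T_k` carry glued-block data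
((BLOCKS) `hTE`, (GLUED) `hS`, (QS) `hqs`, as in `AVSlots.exists_coeff_eq_zero_off_balanced_of_prod_gluedBlocks`),
let no non-zero `H¹(S(ℂ); ℚ) → H¹(A(ℂ); ℚ)` be a morphism of Hodge structures, let `B` have `n` slots over `A` and
`Z` have `n` slots over `S` (e.g. `B = A^{N+1}`, `Z = S^{N+1}`). Then every rational class of Hodge type `(p,p)` on
`B × Z` is a `ℂ`-combination of exterior products `pr_B^* a ⌣ pr_Z^* b` of RATIONAL HODGE classes `a` of `B` and
`b` of `Z`. [cite: MoonenZarhin1999LowDim, §2 (2.2), §3 (3.1) and Lemma (3.4)]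
[cite: VoisinHodgeI2002, §11.3.2 Thm. 11.38] -/
theorem hodgeClassesProductSpan_of_avSlots_of_gluedBlocks
    (hHom : ∀ ψ : bettiCohomology S.X 1 →ₗ[ℚ] bettiCohomology A.X 1, IsHodgeMorphismOne A S ψ → ψ = 0)
    (hgB : AVSlots A B gB) (hgS : AVSlots S Z gS) :
    HodgeClassesProductSpan B Z := by
  classical
  intro p c hcQ hc
  have hB : IsSmoothProjective B.dim B.X := Motives.AbelianVariety.isSmoothProjective_holds
  have hZ : IsSmoothProjective Z.dim Z.X := Motives.AbelianVariety.isSmoothProjective_holds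
  have hXA : IsSmoothProjective A.dim A.X := Motives.AbelianVariety.isSmoothProjective_holds
  have hXS : IsSmoothProjective S.dim S.X := Motives.AbelianVariety.isSmoothProjective_holds
  obtain ⟨hA, bA, h, cS, hbA0, hbA1, hcS0, hcS1, hmain⟩ :=
    (hgB.prodLift hgS).exists_coeff_eq_zero_off_balanced_of_prod_gluedBlocks hint hTE hS hqs hHom
  have hc' : IsOfHodgeType (B.prod Z).dim (B.prod Z).X (2 * p) p p c := by
    rw [Motives.AbelianVariety.dim_prod]; exact hc
  rcases Nat.eq_zero_or_pos p with rfl | hp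
  · -- degree `0`: `c = s · 1 = pr_B^*(s · 1_B) ⌣ pr_Z^* 1_Z`
    have h1 : c ∈ Submodule.span ℂ {singularCohomology.one ℂ (ComplexPoints (B.X ⊗ Z.X))} :=
      mem_divisorClassesSpan_zero (N := B.dim + Z.dim) (IsSmoothProjective.tensor_holds hB hZ) c
    obtain ⟨s, hs⟩ := Submodule.mem_span_singleton.1 h1
    refine mem_span_hodgeProductClasses_of_mem_span_pureType B Z hcQ hc (Submodule.subset_span ?_)
    refine ⟨0, 0, rfl, s • singularCohomology.one ℂ (ComplexPoints B.X), singularCohomology.one ℂ (ComplexPoints Z.X),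
      ⟨0, rfl, isOfHodgeType_zero_zero_of_degree_zero hB _⟩,
      ⟨0, 0, rfl, isOfHodgeType_zero_zero_of_degree_zero hZ _⟩, ?_⟩
    rw [← hs, map_smul, LinearMap.map_smul₂]
    erw [singularCohomology.map_one, singularCohomology.map_one, cupProduct_one]
  · obtain ⟨a, hca, hkill⟩ := hmain hp hcQ hc'
    -- the letters of `B × Z` over `A × S` are `pr_B^*`(letters of `B` over `A`) and `pr_Z^*`(letters of `Z` over `S`)
    set xA : (Fin n × Fin hA) × Fin 2 → complexBetti B.X 1 := fun jr =>
      complexBetti.map (gB jr.1.1).hom.hom.hom 1 (ofRatClassBaseChange (ComplexPoints A.X) 1 (bA (jr.1.2, jr.2)))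
      with hxA
    set y : (Fin n × Fin h) × Fin 2 → complexBetti Z.X 1 := fun jr =>
      complexBetti.map (gS jr.1.1).hom.hom.hom 1 (ofRatClassBaseChange (ComplexPoints S.X) 1 (cS (jr.1.2, jr.2)))
      with hy
    have hletters : (fun jr : (Fin n × (Fin hA ⊕ Fin h)) × Fin 2 => complexBetti.map
        (Motives.AbelianVariety.prodLift (Motives.AbelianVariety.fst B Z ≫ gB jr.1.1)
          (Motives.AbelianVariety.snd B Z ≫ gS jr.1.1)).hom.hom.hom 1
        (Sum.elim
          (fun i => complexBetti.map (Motives.AbelianVariety.fst A S).hom.hom.hom 1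
            (ofRatClassBaseChange (ComplexPoints A.X) 1 (bA (i, jr.2))))
          (fun i => complexBetti.map (Motives.AbelianVariety.snd A S).hom.hom.hom 1
            (ofRatClassBaseChange (ComplexPoints S.X) 1 (cS (i, jr.2))))
          jr.1.2)) =
        fun jr : (Fin n × (Fin hA ⊕ Fin h)) × Fin 2 => Sum.elim
          (fun i => complexBetti.map (Motives.AbelianVariety.fst B Z).hom.hom.hom 1 (xA ((jr.1.1, i), jr.2)))
          (fun i => complexBetti.map (Motives.AbelianVariety.snd B Z).hom.hom.hom 1 (y ((jr.1.1, i), jr.2)))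
          jr.1.2 := by
      funext jr
      obtain ⟨⟨j, t⟩, r⟩ := jr
      rcases t with i | i
      · simp only [Sum.elim_inl, hxA]
        rw [complexBetti_map_map_hom, complexBetti_map_map_hom, Motives.AbelianVariety.prodLift_fst]
      · simp only [Sum.elim_inr, hy]
        rw [complexBetti_map_map_hom, complexBetti_map_map_hom, Motives.AbelianVariety.prodLift_snd]
    -- types of the letters
    have hxA0 : ∀ jr : (Fin n × Fin hA) × Fin 2, jr.2 = 0 → IsOfHodgeType B.dim B.X 1 1 0 (xA jr) := by
      rintro ⟨⟨j, i⟩, r⟩ hr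
      change r = 0 at hr
      subst hr
      exact (hbA0 i).map_of_isSmoothProjective hB hXA _
    have hxA1 : ∀ jr : (Fin n × Fin hA) × Fin 2, jr.2 = 1 → IsOfHodgeType B.dim B.X 1 0 1 (xA jr) := by
      rintro ⟨⟨j, i⟩, r⟩ hr
      change r = 1 at hr
      subst hr
      exact (hbA1 i).map_of_isSmoothProjective hB hXA _
    have hy0 : ∀ jr : (Fin n × Fin h) × Fin 2, jr.2 = 0 → IsOfHodgeType Z.dim Z.X 1 1 0 (y jr) := by
      rintro ⟨⟨j, i⟩, r⟩ hr
      change r = 0 at hr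
      subst hr
      exact (hcS0 i).map_of_isSmoothProjective hZ hXS _
    have hy1 : ∀ jr : (Fin n × Fin h) × Fin 2, jr.2 = 1 → IsOfHodgeType Z.dim Z.X 1 0 1 (y jr) := by
      rintro ⟨⟨j, i⟩, r⟩ hr
      change r = 1 at hr
      subst hr
      exact (hcS1 i).map_of_isSmoothProjective hZ hXS _
    -- evaluate and feed the typed criterion
    have hmem := wordEval_mem_span_typed_cup_pureType_of_eq_zero_off_balanced
      (Motives.AbelianVariety.fst B Z) (Motives.AbelianVariety.snd B Z) xA y hxA0 hxA1 hy0 hy1 hkill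
    rw [← hletters, hca] at hmem
    refine mem_span_hodgeProductClasses_of_mem_span_pureType B Z hcQ hc (Submodule.span_mono ?_ hmem)
    rintro z ⟨i, j, hij, d, μ, hd, hμ, rfl⟩
    exact ⟨i, j, hij, d, μ, hd, hμ, rfl⟩

/-- **`HodgeClassesProductSpan A S`** for `S` with glued blocks and `Hom_Hdg(H¹(S), H¹(A)) = 0` (one slot on each
side). [cite: MoonenZarhin1999LowDim, §2 (2.2), §3 (3.1) and Lemma (3.4)] -/
theorem hodgeClassesProductSpan_of_gluedBlocks
    (hHom : ∀ ψ : bettiCohomology S.X 1 →ₗ[ℚ] bettiCohomology A.X 1, IsHodgeMorphismOne A S ψ → ψ = 0) :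
    HodgeClassesProductSpan A S :=
  hodgeClassesProductSpan_of_avSlots_of_gluedBlocks hint hTE hS hqs hHom (avSlots_self A) (avSlots_self S)

/-- **All equal powers: `HodgeClassesProductSpan (A^{N+1}) (S^{N+1})`** (slots `avPowSlots` on both sides) —
Moonen–Zarhin (3.1) for `m = n`: the Hodge ring of `A^{N+1} × S^{N+1}` is generated by the classes coming from the
two factors. [cite: MoonenZarhin1999LowDim, §2 (2.2), §3 (3.1) and Lemma (3.4)] -/
theorem hodgeClassesProductSpan_powSucc_powSucc_of_gluedBlocks
    (hHom : ∀ ψ : bettiCohomology S.X 1 →ₗ[ℚ] bettiCohomology A.X 1, IsHodgeMorphismOne A S ψ → ψ = 0) (N : ℕ) :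
    HodgeClassesProductSpan (A.powSucc N) (S.powSucc N) :=
  hodgeClassesProductSpan_of_avSlots_of_gluedBlocks hint hTE hS hqs hHom (AVSlots.powSucc A N) (AVSlots.powSucc S N)

/-- **Geometric form: `Hom(A, S) = 0` ⟹ `HodgeClassesProductSpan (A^{N+1}) (S^{N+1})`** for `S` with glued blocks
(Riemann / Deligne–Milne 6.20 turns `Hom(A, S) = 0` into `Hom_Hdg(H¹(S), H¹(A)) = 0`).
[cite: MoonenZarhin1999LowDim, §3 (3.1), Lemma (3.4) and §5 (5.4)] [cite: DeligneMilne1982Tannakian, §6 Thm. 6.20] -/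
theorem hodgeClassesProductSpan_powSucc_powSucc_of_gluedBlocks_of_forall_hom_eq_zero (hAS : ∀ u : A ⟶ S, u = 0)
    (N : ℕ) : HodgeClassesProductSpan (A.powSucc N) (S.powSucc N) :=
  hodgeClassesProductSpan_powSucc_powSucc_of_gluedBlocks hint hTE hS hqs
    (forall_isHodgeMorphismOne_eq_zero_of_forall_hom_eq_zero hAS) N

/-- `HodgeClassesProductSpan A S` from `Hom(A, S) = 0`, `S` with glued blocks.
[cite: MoonenZarhin1999LowDim, §3 (3.1), Lemma (3.4) and §5 (5.4)] -/
theorem hodgeClassesProductSpan_of_gluedBlocks_of_forall_hom_eq_zero (hAS : ∀ u : A ⟶ S, u = 0) :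
    HodgeClassesProductSpan A S :=
  hodgeClassesProductSpan_of_gluedBlocks hint hTE hS hqs (forall_isHodgeMorphismOne_eq_zero_of_forall_hom_eq_zero hAS)

/-! ### §2 Condition (D) for `A × S`, `S` with glued blocks -/

/-- **If `A` satisfies condition (D), `S` with glued blocks satisfies condition (D) and `Hom(A, S) = 0`, then
`A × S` satisfies condition (D)** («`Hg(X × S) = Hg(X) × Hg(S)`», Moonen–Zarhin Lemma (3.4) with (2.2), and the §3
glue: product span on all equal powers + (D) for both factors ⟹ (D) for the product).
[cite: MoonenZarhin1999LowDim, §3 (3.1), Thm. (3.2), Lemma (3.4) and §5 (5.2)] [cite: Gordon1999HodgeAVSurvey, Def. 7.6] -/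
theorem IsStablyNondegenerate.prod_gluedBlocks_of_forall_hom_eq_zero (hA : IsStablyNondegenerate A)
    (hSD : IsStablyNondegenerate S) (hAS : ∀ u : A ⟶ S, u = 0) : IsStablyNondegenerate (A.prod S) :=
  isStablyNondegenerate_prod_of_forall_productSpan_powSucc A S
    (fun N => hodgeClassesProductSpan_powSucc_powSucc_of_gluedBlocks_of_forall_hom_eq_zero hint hTE hS hqs hAS N)
    hA hSD

/-- The same with the factors in the order `S × A`. [cite: MoonenZarhin1999LowDim, §3 Thm. (3.2) and Lemma (3.4)] -/
theorem IsStablyNondegenerate.gluedBlocks_prod_of_forall_hom_eq_zero (hA : IsStablyNondegenerate A)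
    (hSD : IsStablyNondegenerate S) (hAS : ∀ u : A ⟶ S, u = 0) : IsStablyNondegenerate (S.prod A) :=
  isStablyNondegenerate_prod_of_forall_productSpan_powSucc S A
    (fun N => (hodgeClassesProductSpan_powSucc_powSucc_of_gluedBlocks_of_forall_hom_eq_zero hint hTE hS hqs hAS N).symm)
    hSD hA

end ProductSpan

/-! ### §3 (QS) for a number field acting on `H¹`: non-zero rational operators are non-zero on every `V_κ` -/

section QS

/-- **`ℚ`-independent rational operators have `ℂ`-independent complexifications** (`dim_ℂ 𝔤_ℂ = dim_ℚ 𝔤`,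
`finrank_spanC_eq`, for `𝔤` the span of the family). [cite: Deligne1982HodgeCycles, I §3 (proof of Prop. 3.4)] -/
theorem linearIndependent_baseChange_of_linearIndependent_end {V : Type} [AddCommGroup V] [Module ℚ V]
    [Module.Finite ℚ V] {d : ℕ} {u : Fin d → Module.End ℚ V} (hu : LinearIndependent ℚ u) :
    LinearIndependent ℂ fun j => (u j).baseChange ℂ := by
  rw [linearIndependent_iff_card_eq_finrank_span, Fintype.card_fin]
  have hspan : Submodule.span ℂ (Set.range fun j => (u j).baseChange ℂ) = spanC (Submodule.span ℚ (Set.range u)) := by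
    apply le_antisymm
    · rw [Submodule.span_le]
      rintro _ ⟨j, rfl⟩
      exact baseChange_mem_spanC (Submodule.subset_span ⟨j, rfl⟩)
    · rw [spanC, Submodule.span_le]
      rintro _ ⟨Z, hZ, rfl⟩
      have hZ' : Z ∈ Submodule.span ℚ (Set.range u) := hZ
      change Z.baseChange ℂ ∈ Submodule.span ℂ (Set.range fun j => (u j).baseChange ℂ)
      clear hZ
      induction hZ' using Submodule.span_induction with
      | mem _ h =>
        obtain ⟨j, rfl⟩ := h
        exact Submodule.subset_span ⟨j, rfl⟩
      | zero => rw [LinearMap.baseChange_zero]; exact Submodule.zero_mem _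
      | add Z Z' _ _ hZ hZ' => rw [LinearMap.baseChange_add]; exact Submodule.add_mem _ hZ hZ'
      | smul q Z _ hZ =>
        rw [LinearMap.baseChange_smul, ← Rat.cast_smul_eq_qsmul ℂ q]; exact Submodule.smul_mem _ _ hZ
  rw [Set.finrank, hspan, finrank_spanC_eq, finrank_span_eq_card hu, Fintype.card_fin]

variable {S : AbelianVariety ℂ} {K : Type} [Field K] [NumberField K] (φ : K →+* S.endAlgebra)

/-- **(QS) for the joint eigenspaces of a number field acting on `H¹(S(ℂ); ℚ)`.** A non-zero RATIONAL operator
`Y` of `H¹(S)` has complexification `Y_ℂ` non-zero on EVERY joint eigenspace `V_κ` (`κ : K → ℂ`) of the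
`(φ y)^*`, `y ∈ K` (no commutation needed: the `V_κ` are conjugate under `Aut(ℂ/ℚ)` and `ker Y` is rational):
otherwise `Y_ℂ ∘ P(α_ℂ) = 0` for `α` a primitive element and `P = ∏_{κ' ≠ κ} (X − κ'(α))` (`P(α_ℂ)` kills
`V_{κ'}`, `κ' ≠ κ`, and is a scalar on `V_κ`; `H¹ ⊗ ℂ = ⊕ V_κ'`), a `ℂ`-relation with leading coefficient `1`
among the `(Y α^j)_ℂ`, `j < [K:ℚ]`, which are `ℚ`-independent (`Y ≠ 0`, `K` a field) hence `ℂ`-independent.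
(Hazama: `V_ℂ = ⊕ V_i` with the `K`-linear maps acting componentwise; the standard representation of
`R_{K/ℚ} SL₂` restricted to each factor is non-zero.) [cite: Hazama1983, §3 (pp. 305–306)]
[cite: Deligne1982HodgeCycles, §4 p. 30] -/
theorem exists_mem_jointEigenspace_baseChange_ne_zero (hHD : exists_isReal_hodgeModel)
    (hI : hodgePQ_independent_of_hodgeModel) {Y : Module.End ℚ (bettiCohomology S.X 1)} (hY0 : Y ≠ 0)
    (κ₀ : K →+* ℂ) :
    ∃ x ∈ jointEigenspace φ κ₀, Y.baseChange ℂ x ≠ 0 := by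
  classical
  haveI : Module.Finite ℚ (bettiCohomology S.X 1) := finite_bettiCohomology_one S
  by_contra hall
  simp only [not_exists, not_and, not_not] at hall
  -- a primitive element `α` of `K`, `d = [K:ℚ]`
  let pb := Field.powerBasisOfFiniteOfSeparable ℚ K
  have hdK : Module.finrank ℚ K = pb.dim := pb.finrank
  have hcard : Fintype.card (K →+* ℂ) = pb.dim := by rw [NumberField.Embeddings.card, hdK]
  have hd0 : 0 < pb.dim := by rw [← hdK]; exact Module.finrank_pos
  obtain ⟨Aα, hAα⟩ : ∃ Aα : Module.End ℚ (bettiCohomology S.X 1), Aα = hOneAlgHom φ pb.gen := ⟨_, rfl⟩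
  have hpow : ∀ j : ℕ, (Aα ^ j).baseChange ℂ = Aα.baseChange ℂ ^ j := fun j => by rw [LinearMap.baseChange_pow]
  have heig : ∀ κ, ∀ x ∈ jointEigenspace φ κ, Aα.baseChange ℂ x = κ pb.gen • x := fun κ x hx => by
    rw [hAα]; exact (mem_jointEigenspace_iff φ κ x).1 hx pb.gen
  -- the polynomial `P = ∏_{κ ≠ κ₀} (X - κ(α))`
  set P : Polynomial ℂ := ∏ κ ∈ Finset.univ.erase κ₀, (Polynomial.X - Polynomial.C (κ pb.gen)) with hP
  have hPmonic : P.Monic :=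
    Polynomial.monic_prod_of_monic _ _ fun κ _ => Polynomial.monic_X_sub_C (κ pb.gen)
  have hPdeg : P.natDegree = pb.dim - 1 := by
    rw [hP, Polynomial.natDegree_prod_of_monic _ _ fun κ _ => Polynomial.monic_X_sub_C (κ pb.gen)]
    simp only [Polynomial.natDegree_X_sub_C, Finset.sum_const, smul_eq_mul, mul_one,
      Finset.card_erase_of_mem (Finset.mem_univ κ₀), Finset.card_univ, hcard]
  have haev : ∀ κ, ∀ x ∈ jointEigenspace φ κ,
      Polynomial.aeval (Aα.baseChange ℂ) P x = P.eval (κ pb.gen) • x := by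
    intro κ x hx
    by_cases hx0 : x = 0
    · rw [hx0, map_zero, smul_zero]
    · exact Module.End.aeval_apply_of_hasEigenvector
        (Module.End.hasEigenvector_iff.2 ⟨Module.End.mem_eigenspace_iff.2 (heig κ x hx), hx0⟩)
  have heval : ∀ κ, κ ≠ κ₀ → P.eval (κ pb.gen) = 0 := fun κ hκ => by
    rw [hP, Polynomial.eval_prod]
    exact Finset.prod_eq_zero (Finset.mem_erase.2 ⟨hκ, Finset.mem_univ κ⟩)
      (by rw [Polynomial.eval_sub, Polynomial.eval_X, Polynomial.eval_C, sub_self])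
  -- `Y_ℂ ∘ P(α_ℂ) = 0` on `H¹ ⊗ ℂ = ⊕ V_κ`
  have hzero : Y.baseChange ℂ * Polynomial.aeval (Aα.baseChange ℂ) P = 0 := by
    refine LinearMap.ext fun x => ?_
    have hx : x ∈ ⨆ κ, jointEigenspace (A := S) φ κ := by
      rw [(isInternal_jointEigenspace φ hHD hI).submodule_iSup_eq_top]; exact Submodule.mem_top
    rw [LinearMap.zero_apply]
    induction hx using Submodule.iSup_induction' with
    | mem κ x hx =>
      rw [Module.End.mul_apply, haev κ x hx, map_smul]
      by_cases hκ : κ = κ₀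
      · subst hκ
        rw [hall x hx, smul_zero]
      · rw [heval κ hκ, zero_smul]
    | zero => rw [map_zero]
    | add x x' _ _ hx hx' => rw [map_add, hx, hx', add_zero]
  have hexp : Polynomial.aeval (Aα.baseChange ℂ) P =
      ∑ j ∈ Finset.range pb.dim, P.coeff j • (Aα ^ j).baseChange ℂ := by
    rw [Polynomial.aeval_eq_sum_range' (p := P) (n := pb.dim) (by rw [hPdeg]; omega)]
    exact Finset.sum_congr rfl fun j _ => by rw [hpow]
  -- the `Y α^j`, `j < d`, are `ℚ`-independent
  have hu : LinearIndependent ℚ fun j : Fin pb.dim => Y * Aα ^ (j : ℕ) := by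
    rw [Fintype.linearIndependent_iff]
    intro g hg
    set y : K := ∑ j, g j • pb.gen ^ (j : ℕ) with hy
    have hYy : Y * hOneAlgHom φ y = 0 := by
      have h : Y * hOneAlgHom φ y = ∑ j, g j • (Y * Aα ^ (j : ℕ)) := by
        rw [hy, map_sum, Finset.mul_sum]
        refine Finset.sum_congr rfl fun j _ => ?_
        rw [map_smul, map_pow, ← hAα, mul_smul_comm]
      exact h.trans hg
    by_cases hy0 : y = 0
    · have h' : ∑ j, g j • pb.basis j = 0 := by
        simp only [PowerBasis.coe_basis]
        rw [← hy]; exact hy0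
      exact Fintype.linearIndependent_iff.1 pb.basis.linearIndependent g h'
    · exfalso
      apply hY0
      calc Y = Y * hOneAlgHom φ y * hOneAlgHom φ y⁻¹ := by
            rw [mul_assoc, ← map_mul, mul_inv_cancel₀ hy0, map_one, mul_one]
        _ = 0 := by rw [hYy, zero_mul]
  have hli := linearIndependent_baseChange_of_linearIndependent_end hu
  -- the non-trivial relation
  have hrel : ∑ j : Fin pb.dim, P.coeff j • (Y * Aα ^ (j : ℕ)).baseChange ℂ = 0 := by
    calc ∑ j : Fin pb.dim, P.coeff (j : ℕ) • (Y * Aα ^ (j : ℕ)).baseChange ℂ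
        = ∑ j ∈ Finset.range pb.dim, P.coeff j • (Y * Aα ^ j).baseChange ℂ :=
          (Finset.sum_range fun j => P.coeff j • (Y * Aα ^ j).baseChange ℂ).symm
      _ = Y.baseChange ℂ * Polynomial.aeval (Aα.baseChange ℂ) P := by
          rw [hexp, Finset.mul_sum]
          exact Finset.sum_congr rfl fun j _ => by rw [mul_smul_comm, LinearMap.baseChange_mul]
      _ = 0 := hzero
  have hcoef : P.coeff (pb.dim - 1) = 0 :=
    Fintype.linearIndependent_iff.1 hli (fun j => P.coeff j) hrel ⟨pb.dim - 1, by omega⟩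
  have h1 : P.coeff (pb.dim - 1) = 1 := by rw [← hPdeg]; exact hPmonic.coeff_natDegree
  exact one_ne_zero (h1.symm.trans hcoef)

end QS

/-! ### §4 THE MURTY ROW: `S` with a totally real self-commutant subfield `K ⊆ End⁰(S)`, `dim S = [K:ℚ]` -/

section MurtyOne

variable {A B S Z : AbelianVariety ℂ} {n : ℕ} {gB : Fin n → (B ⟶ A)} {gS : Fin n → (Z ⟶ S)}
variable {K : Type} [Field K] [NumberField K] {φ : K →+* S.endAlgebra}

/-- **`HodgeClassesProductSpan B Z` for slots over `A` and over `S` of Murty type with `m = 1`** (`K` totally real,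
`φ : K →+* End⁰(S)` its own commutant, `dim S = [K:ℚ]`; «Type 1(2): … `Hg(X) = Res_{F/ℚ} Sp_F(V,ψ)`» for surfaces),
`Hom_Hdg(H¹(S), H¹(A)) = 0`: the glued data of §1 DISCHARGED on the joint eigenspaces `V_κ`
(`exists_glued_adapted_blockBasis_of_isMurtyTypeWith_one`, `mapsTo_jointEigenspace_of_forall_commute`, §3).
[cite: MoonenZarhin1999LowDim, §2 (2.2), §3 (3.1) and Lemma (3.4)] [cite: Murty1988, Thm. 2 (p. 67)]
[cite: Hazama1983, §3 (pp. 305–306)] -/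
theorem hodgeClassesProductSpan_of_avSlots_of_isMurtyTypeWith_one (hSm : IsMurtyTypeWith S K φ 1)
    (hHom : ∀ ψ : bettiCohomology S.X 1 →ₗ[ℚ] bettiCohomology A.X 1, IsHodgeMorphismOne A S ψ → ψ = 0)
    (hgB : AVSlots A B gB) (hgS : AVSlots S Z gS) : HodgeClassesProductSpan B Z := by
  classical
  haveI : HodgeTensorFacts.{0, 0} := hodgeTensorFacts_holds.{0, 0}
  have hHD₀ : exists_isReal_hodgeModel := exists_isReal_hodgeModel_holds
  have hI₀ : hodgePQ_independent_of_hodgeModel := hodgePQ_independent_of_hodgeModel_holds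
  haveI : Nonempty (K →+* ℂ) :=
    Fintype.card_pos_iff.1 (by rw [NumberField.Embeddings.card]; exact Module.finrank_pos)
  exact hodgeClassesProductSpan_of_avSlots_of_gluedBlocks (isInternal_jointEigenspace φ hHD₀ hI₀)
    (fun hHD hI Y hY k => mapsTo_jointEigenspace_of_forall_commute φ hHD hI hY k)
    (@fun hHD hI ψ Θ hΘ => exists_glued_adapted_blockBasis_of_isMurtyTypeWith_one φ hSm hHD hI ψ hΘ)
    (fun hHD hI Y _ hY0 k => exists_mem_jointEigenspace_baseChange_ne_zero φ hHD hI hY0 k)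
    hHom hgB hgS

/-- **All equal powers: `HodgeClassesProductSpan (A^{N+1}) (S^{N+1})`**, `S` of Murty type with `m = 1`,
`Hom(A, S) = 0`. [cite: MoonenZarhin1999LowDim, §3 (3.1), Lemma (3.4) and §5 (5.4)] [cite: Murty1988, Thm. 2 (p. 67)] -/
theorem hodgeClassesProductSpan_powSucc_powSucc_of_isMurtyTypeWith_one_of_forall_hom_eq_zero
    (hSm : IsMurtyTypeWith S K φ 1) (hAS : ∀ u : A ⟶ S, u = 0) (N : ℕ) :
    HodgeClassesProductSpan (A.powSucc N) (S.powSucc N) :=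
  hodgeClassesProductSpan_of_avSlots_of_isMurtyTypeWith_one hSm
    (forall_isHodgeMorphismOne_eq_zero_of_forall_hom_eq_zero hAS) (AVSlots.powSucc A N) (AVSlots.powSucc S N)

/-- `HodgeClassesProductSpan A S`, `S` of Murty type with `m = 1`, `Hom(A, S) = 0`.
[cite: MoonenZarhin1999LowDim, §3 (3.1) and Lemma (3.4)] [cite: Murty1988, Thm. 2 (p. 67)] -/
theorem hodgeClassesProductSpan_of_isMurtyTypeWith_one_of_forall_hom_eq_zero (hSm : IsMurtyTypeWith S K φ 1)
    (hAS : ∀ u : A ⟶ S, u = 0) : HodgeClassesProductSpan A S :=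
  hodgeClassesProductSpan_of_avSlots_of_isMurtyTypeWith_one hSm
    (forall_isHodgeMorphismOne_eq_zero_of_forall_hom_eq_zero hAS) (avSlots_self A) (avSlots_self S)

/-- **THE MURTY ROW (Moonen–Zarhin Lemma (3.4) with Thm. (3.2), PROVED): if `A` satisfies condition (D), `S` is of
Murty type with `m = 1` and `Hom(A, S) = 0`, then `A × S` satisfies condition (D)** — `S` is (D) by the tree's
`isDivisorGenerated_powSucc_of_isMurtyTypeWith_one` (Murty's Thm. 2 at `m = 1`, proved there).
[cite: MoonenZarhin1999LowDim, §3 Thm. (3.2), Lemma (3.4) and §5 (5.2)] [cite: Murty1988, Thm. 2 (p. 67)]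
[cite: Gordon1999HodgeAVSurvey, Def. 7.6] -/
theorem IsStablyNondegenerate.prod_isMurtyTypeWith_one_of_forall_hom_eq_zero (hA : IsStablyNondegenerate A)
    (hSm : IsMurtyTypeWith S K φ 1) (hAS : ∀ u : A ⟶ S, u = 0) : IsStablyNondegenerate (A.prod S) :=
  isStablyNondegenerate_prod_of_forall_productSpan_powSucc A S
    (fun N => hodgeClassesProductSpan_powSucc_powSucc_of_isMurtyTypeWith_one_of_forall_hom_eq_zero hSm hAS N) hA
    (fun N => AbelianVariety.isDivisorGenerated_powSucc_of_isMurtyTypeWith_one S hSm N)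

/-- The same in the order `S × A`. [cite: MoonenZarhin1999LowDim, §3 Thm. (3.2) and Lemma (3.4)] [cite: Murty1988, Thm. 2 (p. 67)] -/
theorem IsStablyNondegenerate.isMurtyTypeWith_one_prod_of_forall_hom_eq_zero (hA : IsStablyNondegenerate A)
    (hSm : IsMurtyTypeWith S K φ 1) (hAS : ∀ u : A ⟶ S, u = 0) : IsStablyNondegenerate (S.prod A) :=
  isStablyNondegenerate_prod_of_forall_productSpan_powSucc S A
    (fun N => (hodgeClassesProductSpan_powSucc_powSucc_of_isMurtyTypeWith_one_of_forall_hom_eq_zero hSm hAS N).symm)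
    (fun N => AbelianVariety.isDivisorGenerated_powSucc_of_isMurtyTypeWith_one S hSm N) hA

/-- All mixed powers `A^{a+1} × S^{b+1}` are then stably nondegenerate; in particular the Hodge conjecture holds
for them. [cite: MoonenZarhin1999LowDim, §3 Thm. (3.2)] [cite: vanGeemen1994HodgeAV, §3.6 (p. 236)] -/
theorem IsStablyNondegenerate.powSucc_prod_isMurtyTypeWith_one_powSucc_of_forall_hom_eq_zero
    (hA : IsStablyNondegenerate A) (hSm : IsMurtyTypeWith S K φ 1) (hAS : ∀ u : A ⟶ S, u = 0) (a b : ℕ) :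
    IsStablyNondegenerate ((A.powSucc a).prod (S.powSucc b)) :=
  (hA.prod_isMurtyTypeWith_one_of_forall_hom_eq_zero hSm hAS).powSucc_prod_powSucc a b

/-- **`A × S` with `End⁰(S)` itself a totally real field of degree `dim S`** (Ribet's relative dimension one; the
Murty packet `isMurtyTypeWith_endField` with `r = 1`): `A` (D), `Hom(A, S) = 0` ⟹ `A × S` (D).
[cite: MoonenZarhin1999LowDim, §2 (2.2) Type 1(2), §3 Lemma (3.4)] [cite: Murty1988, Thm. 2 and p. 66 L80–81] -/
theorem IsStablyNondegenerate.prod_isTotallyReal_of_forall_hom_eq_zero (hA : IsStablyNondegenerate A)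
    (hF : IsField S.endAlgebra) [IsTotallyReal (EndField S hF)] (hdeg : Module.finrank ℚ S.endAlgebra = S.dim)
    (hAS : ∀ u : A ⟶ S, u = 0) : IsStablyNondegenerate (A.prod S) :=
  hA.prod_isMurtyTypeWith_one_of_forall_hom_eq_zero
    (isMurtyTypeWith_endField S hF inferInstance (r := 1) (by rw [mul_one, hdeg]) odd_one) hAS

end MurtyOne

/-! ### §5 THE QUATERNION ROW: `S` simple with a real splitting `ℝ ⊗ End⁰(S) ≃ ∏_ι M₂(ℝ)`, `dim S = 2|ι|` -/

section Quaternion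

variable {A B S Z : AbelianVariety ℂ} {n : ℕ} {gB : Fin n → (B ⟶ A)} {gS : Fin n → (Z ⟶ S)}
variable {ι : Type} [Fintype ι] [DecidableEq ι]

/-- **`HodgeClassesProductSpan B Z` for slots over `A` and over a SIMPLE `S` with a real splitting
`Φ : ℝ ⊗ End⁰(S) ≃ ∏_ι M₂(ℝ)`, `dim S = 2|ι|`** («Type 2(1): … `Hg(X)` is the algebraic group `U_{D^opp}`» for
surfaces),
`Hom_Hdg(H¹(S), H¹(A)) = 0`: the glued data of §1 DISCHARGED on the matrix-unit blocks
(`exists_glued_adapted_blockBasis_of_realSplitting`, `RealSplitting.mapsTo_block_of_forall_commute`); (QS): a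
non-zero rational operator commuting with `End⁰(S)` — a division algebra of dimension `dim_ℚ H¹(S)` — is invertible
(`AntiRep.eq_zero_or_isUnit_of_forall_commute`), and the blocks are two-dimensional (`RealSplitting.finrank_block`).
[cite: MoonenZarhin1999LowDim, §2 (2.2), §3 (3.1) and Lemma (3.4)] [cite: BanaszakGajdaKrason2006, (7.22) and Thm. 7.34]
[cite: Murty1988, Thm. 2 (p. 67)] -/
theorem hodgeClassesProductSpan_of_avSlots_of_realSplitting [Nonempty ι] (hSs : S.IsSimple)
    (Φ : ℝ ⊗[ℚ] S.endAlgebra ≃ₐ[ℝ] (ι → Matrix (Fin 2) (Fin 2) ℝ)) (hdim : S.dim = 2 * Fintype.card ι)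
    (hHom : ∀ ψ : bettiCohomology S.X 1 →ₗ[ℚ] bettiCohomology A.X 1, IsHodgeMorphismOne A S ψ → ψ = 0)
    (hgB : AVSlots A B gB) (hgS : AVSlots S Z gS) : HodgeClassesProductSpan B Z := by
  classical
  haveI : HodgeTensorFacts.{0, 0} := hodgeTensorFacts_holds.{0, 0}
  haveI : Module.Finite ℚ (bettiCohomology S.X 1) := finite_bettiCohomology_one S
  haveI : Module.Finite ℚ S.endAlgebra := AbelianVariety.finiteDimensional_endAlgebra_holds S
  have hdiv : ∀ z : S.endAlgebra, IsUnit z ∨ z = 0 := isUnit_or_eq_zero_of_isSimple hSs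
  have hdeg : Module.finrank ℚ S.endAlgebra = Module.finrank ℚ (bettiCohomology S.X 1) :=
    finrank_endAlgebra_eq_finrank_bettiCohomology_one_of_realSplitting Φ hdim
  have hV : Module.finrank ℚ (bettiCohomology S.X 1) = 2 * S.dim := finrank_bettiCohomology_one S
  haveI : Nontrivial (bettiCohomology S.X 1) := Module.nontrivial_of_finrank_pos (R := ℚ) (by
    rw [hV, hdim]; have := Fintype.card_pos (α := ι); omega)
  refine hodgeClassesProductSpan_of_avSlots_of_gluedBlocks (RealSplitting.isInternal_block (bettiRep S) Φ)
    (fun hHD hI Y hY k => RealSplitting.mapsTo_block_of_forall_commute (bettiRep S) Φ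
      (BettiUniverse.hodge hHD (AbelianVariety.isSmoothProjective_holds (A := S)) 1)
      (unop_bettiRep_mem_endAlg hHD hI) hY k)
    (@fun hHD hI ψ Θ hΘ => exists_glued_adapted_blockBasis_of_realSplitting hSs Φ hdim hHD hI ψ hΘ)
    (fun hHD hI Y hY hY0 k => ?_) hHom hgB hgS
  -- (QS)
  rcases AntiRep.eq_zero_or_isUnit_of_forall_commute (bettiRep S) hdiv hdeg
      (fun z => hY ⟨_, unop_bettiRep_mem_endAlg hHD hI z⟩) with h0 | ⟨u, hu⟩
  · exact absurd h0 hY0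
  · have h2 : Module.finrank ℂ (RealSplitting.block (bettiRep S) Φ k) = 2 :=
      RealSplitting.finrank_block (bettiRep S) Φ hdiv hdeg k
    obtain ⟨x, hx, hx0⟩ := Submodule.exists_mem_ne_zero_of_ne_bot (p := RealSplitting.block (bettiRep S) Φ k)
      (fun hb => by have h0 := Submodule.finrank_eq_zero.2 hb; omega)
    refine ⟨x, hx, fun hYx => hx0 ?_⟩
    have hinv : (↑u⁻¹ : Module.End ℚ (bettiCohomology S.X 1)).baseChange ℂ * Y.baseChange ℂ = 1 := by
      rw [← LinearMap.baseChange_mul, ← hu, Units.inv_mul, LinearMap.baseChange_one]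
    calc x = ((↑u⁻¹ : Module.End ℚ (bettiCohomology S.X 1)).baseChange ℂ * Y.baseChange ℂ) x := by
          rw [hinv, Module.End.one_apply]
      _ = 0 := by rw [Module.End.mul_apply, hYx, map_zero]

/-- **(D) for `A × S`, `S` simple with a real splitting and `dim S = 2|ι|`, `A` (D), `Hom(A, S) = 0`** — `S` is
(D) by the tree's `isDivisorGenerated_powSucc_of_isSimple_realSplitting` (BGK Thm. 7.34, `h = 1`).
[cite: MoonenZarhin1999LowDim, §3 Thm. (3.2) and Lemma (3.4)] [cite: BanaszakGajdaKrason2006, Thm. 7.34] -/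
theorem IsStablyNondegenerate.prod_realSplitting_of_forall_hom_eq_zero [Nonempty ι] (hA : IsStablyNondegenerate A)
    (hSs : S.IsSimple) (Φ : ℝ ⊗[ℚ] S.endAlgebra ≃ₐ[ℝ] (ι → Matrix (Fin 2) (Fin 2) ℝ))
    (hdim : S.dim = 2 * Fintype.card ι) (hAS : ∀ u : A ⟶ S, u = 0) : IsStablyNondegenerate (A.prod S) :=
  isStablyNondegenerate_prod_of_forall_productSpan_powSucc A S
    (fun N => hodgeClassesProductSpan_of_avSlots_of_realSplitting hSs Φ hdim
      (forall_isHodgeMorphismOne_eq_zero_of_forall_hom_eq_zero hAS) (AVSlots.powSucc A N)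
      (AVSlots.powSucc S N)) hA
    (fun N => AbelianVariety.isDivisorGenerated_powSucc_of_isSimple_realSplitting S hSs Φ hdim N)

variable {K : Type} [Field K] [NumberField K] [Algebra K S.endAlgebra] [IsScalarTower ℚ K S.endAlgebra]
  [IsQuaternionAlgebra K S.endAlgebra]

/-- **`HodgeClassesProductSpan B Z` for slots over `A` and over a simple `S` with `End⁰(S)` a quaternion algebra
over a totally real `K`, `dim S = 2[K:ℚ]`** (type III being impossible, `End⁰(S)` is totally indefinite:
`isTotallyIndefinite_of_isSimple_of_dim_eq`; the real splitting `nonempty_realSplitting_of_isSimple_isTotallyIndefinite`),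
`Hom_Hdg(H¹(S), H¹(A)) = 0`. [cite: MoonenZarhin1999LowDim, §2 (2.2) Type 2(1), §3 Lemma (3.4)]
[cite: BanaszakGajdaKrason2006, Thm. 7.34] [cite: MumfordAV1970, §21 Thm. 2 (type II)] -/
theorem hodgeClassesProductSpan_of_avSlots_of_isSimple_quaternion_of_dim_eq [IsTotallyReal K] (hSs : S.IsSimple)
    (hdim : S.dim = 2 * Module.finrank ℚ K)
    (hHom : ∀ ψ : bettiCohomology S.X 1 →ₗ[ℚ] bettiCohomology A.X 1, IsHodgeMorphismOne A S ψ → ψ = 0)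
    (hgB : AVSlots A B gB) (hgS : AVSlots S Z gS) : HodgeClassesProductSpan B Z := by
  classical
  obtain ⟨Φ⟩ := nonempty_realSplitting_of_isSimple_isTotallyIndefinite hSs
    (AbelianVariety.isTotallyIndefinite_of_isSimple_of_dim_eq hSs hdim)
  exact hodgeClassesProductSpan_of_avSlots_of_realSplitting hSs Φ
    (by rw [card_infinitePlace_eq_finrank_of_isTotallyReal K]; exact hdim) hHom hgB hgS

/-- **THE QUATERNION ROW (Moonen–Zarhin Lemma (3.4) with Thm. (3.2), PROVED): `A` (D), `S` simple with `End⁰(S)`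
a quaternion algebra over a totally real `K` and `dim S = 2[K:ℚ]`, `Hom(A, S) = 0` ⟹ `A × S` satisfies (D)** —
`S` is (D) by the tree's `isDivisorGenerated_powSucc_of_isSimple_quaternion_of_dim_eq`.
[cite: MoonenZarhin1999LowDim, §3 Thm. (3.2), Lemma (3.4) and §5 (5.2)] [cite: BanaszakGajdaKrason2006, Thm. 7.34]
[cite: Gordon1999HodgeAVSurvey, Def. 7.6] -/
theorem IsStablyNondegenerate.prod_isSimple_quaternion_of_dim_eq_of_forall_hom_eq_zero [IsTotallyReal K]
    (hA : IsStablyNondegenerate A) (hSs : S.IsSimple) (hdim : S.dim = 2 * Module.finrank ℚ K)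
    (hAS : ∀ u : A ⟶ S, u = 0) : IsStablyNondegenerate (A.prod S) :=
  isStablyNondegenerate_prod_of_forall_productSpan_powSucc A S
    (fun N => hodgeClassesProductSpan_of_avSlots_of_isSimple_quaternion_of_dim_eq hSs hdim
      (forall_isHodgeMorphismOne_eq_zero_of_forall_hom_eq_zero hAS) (AVSlots.powSucc A N)
      (AVSlots.powSucc S N)) hA
    (fun N => AbelianVariety.isDivisorGenerated_powSucc_of_isSimple_quaternion_of_dim_eq hSs hdim N)

/-- The same in the order `S × A`. [cite: MoonenZarhin1999LowDim, §3 Thm. (3.2) and Lemma (3.4)]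
[cite: BanaszakGajdaKrason2006, Thm. 7.34] -/
theorem IsStablyNondegenerate.isSimple_quaternion_of_dim_eq_prod_of_forall_hom_eq_zero [IsTotallyReal K]
    (hA : IsStablyNondegenerate A) (hSs : S.IsSimple) (hdim : S.dim = 2 * Module.finrank ℚ K)
    (hAS : ∀ u : A ⟶ S, u = 0) : IsStablyNondegenerate (S.prod A) :=
  isStablyNondegenerate_prod_of_forall_productSpan_powSucc S A
    (fun N => (hodgeClassesProductSpan_of_avSlots_of_isSimple_quaternion_of_dim_eq hSs hdim
      (forall_isHodgeMorphismOne_eq_zero_of_forall_hom_eq_zero hAS) (AVSlots.powSucc A N)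
      (AVSlots.powSucc S N)).symm)
    (fun N => AbelianVariety.isDivisorGenerated_powSucc_of_isSimple_quaternion_of_dim_eq hSs hdim N) hA

/-- All mixed powers `A^{a+1} × S^{b+1}` are then stably nondegenerate.
[cite: MoonenZarhin1999LowDim, §3 Thm. (3.2)] [cite: vanGeemen1994HodgeAV, §3.6 (p. 236)] -/
theorem IsStablyNondegenerate.powSucc_prod_isSimple_quaternion_powSucc_of_forall_hom_eq_zero [IsTotallyReal K]
    (hA : IsStablyNondegenerate A) (hSs : S.IsSimple) (hdim : S.dim = 2 * Module.finrank ℚ K)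
    (hAS : ∀ u : A ⟶ S, u = 0) (a b : ℕ) : IsStablyNondegenerate ((A.powSucc a).prod (S.powSucc b)) :=
  (hA.prod_isSimple_quaternion_of_dim_eq_of_forall_hom_eq_zero hSs hdim hAS).powSucc_prod_powSucc a b

end Quaternion

/-! ### §6 SURFACES: `A × S` for `S` a simple abelian surface not of CM type; the rows with no `Hom` hypothesis -/

section Surfaces

variable {A S T Y : AbelianVariety ℂ}

/-- **`A × S` satisfies (D) for EVERY `A` satisfying (D) and every SIMPLE abelian SURFACE `S` NOT of CM type with
`Hom(A, S) = 0`** (Moonen–Zarhin Thm. 0.1 (4) / 0.2 (4) rows through Lemma (3.4) with (2.2): `dim_ℚ End⁰(S) = 1`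
type I(1) — the companion's row `prod_lowGeneric_of_forall_hom_eq_zero`; `= 2` type I(2), a REAL quadratic field
(`isTotallyReal_endField_of_surface`) — the Murty row §4; `= 4` non-commutative, type II(1), a quaternion algebra
over `ℚ` (`isQuaternionAlgebra_endAlgebra_of_isSimple`) — the quaternion row §5; `= 4` commutative is CM type
(`isOfCMType_of_isSimple_surface_of_comm_of_finrank_eq_four`), excluded).
[cite: MoonenZarhin1999LowDim, Thm. 0.1 (4), §2 (2.2), §3 Lemma (3.4) and §5 (5.2), (5.4)]
[cite: MumfordAV1970, §19 Cor. 2 of Thm. 1 and §21] -/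
theorem IsStablyNondegenerate.prod_simpleSurface_of_not_isOfCMType_of_forall_hom_eq_zero
    (hA : IsStablyNondegenerate A) (hS : S.IsSimple) (hS2 : S.dim = 2) (hcm : ¬ IsOfCMType S)
    (hAS : ∀ u : A ⟶ S, u = 0) : IsStablyNondegenerate (A.prod S) := by
  classical
  have h0 : 0 < S.dim := by omega
  rcases AbelianVariety.finrank_endAlgebra_eq_of_isSimple_surface hS hS2 with h1 | h2 | h4
  · exact hA.prod_lowGeneric_of_forall_hom_eq_zero h0 (by omega) h1 hAS
  · have hF : IsField S.endAlgebra := AbelianVariety.isField_endAlgebra_of_isSimple_of_finrank_eq_two hS h0 h2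
    haveI : IsTotallyReal (EndField S hF) := AbelianVariety.isTotallyReal_endField_of_surface hS2 h2 hF
    exact hA.prod_isTotallyReal_of_forall_hom_eq_zero hF (by rw [h2, hS2]) hAS
  · by_cases hcomm : ∀ x y : S.endAlgebra, x * y = y * x
    · exact absurd (isOfCMType_of_isSimple_surface_of_comm_of_finrank_eq_four hS hS2 h4 hcomm) hcm
    · simp only [not_forall] at hcomm
      obtain ⟨x, y, hxy⟩ := hcomm
      haveI : IsQuaternionAlgebra ℚ S.endAlgebra :=
        AbelianVariety.isQuaternionAlgebra_endAlgebra_of_isSimple hS h0 h4 ⟨x, y, hxy⟩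
      exact hA.prod_isSimple_quaternion_of_dim_eq_of_forall_hom_eq_zero (K := ℚ) hS
        (by rw [Module.finrank_self, mul_one]; exact hS2) hAS

/-- The same in the order `S × A`. [cite: MoonenZarhin1999LowDim, Thm. 0.1 (4), §2 (2.2) and §3 Lemma (3.4)] -/
theorem IsStablyNondegenerate.simpleSurface_of_not_isOfCMType_prod_of_forall_hom_eq_zero
    (hA : IsStablyNondegenerate A) (hS : S.IsSimple) (hS2 : S.dim = 2) (hcm : ¬ IsOfCMType S)
    (hAS : ∀ u : A ⟶ S, u = 0) : IsStablyNondegenerate (S.prod A) := by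
  classical
  have h0 : 0 < S.dim := by omega
  rcases AbelianVariety.finrank_endAlgebra_eq_of_isSimple_surface hS hS2 with h1 | h2 | h4
  · exact hA.lowGeneric_prod_of_forall_hom_eq_zero h0 (by omega) h1 hAS
  · have hF : IsField S.endAlgebra := AbelianVariety.isField_endAlgebra_of_isSimple_of_finrank_eq_two hS h0 h2
    haveI : IsTotallyReal (EndField S hF) := AbelianVariety.isTotallyReal_endField_of_surface hS2 h2 hF
    exact hA.isMurtyTypeWith_one_prod_of_forall_hom_eq_zero
      (isMurtyTypeWith_endField S hF inferInstance (r := 1) (by rw [mul_one, h2, hS2]) odd_one) hAS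
  · by_cases hcomm : ∀ x y : S.endAlgebra, x * y = y * x
    · exact absurd (isOfCMType_of_isSimple_surface_of_comm_of_finrank_eq_four hS hS2 h4 hcomm) hcm
    · simp only [not_forall] at hcomm
      obtain ⟨x, y, hxy⟩ := hcomm
      haveI : IsQuaternionAlgebra ℚ S.endAlgebra :=
        AbelianVariety.isQuaternionAlgebra_endAlgebra_of_isSimple hS h0 h4 ⟨x, y, hxy⟩
      exact hA.isSimple_quaternion_of_dim_eq_prod_of_forall_hom_eq_zero (K := ℚ) hS
        (by rw [Module.finrank_self, mul_one]; exact hS2) hAS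

/-- All mixed powers `A^{a+1} × S^{b+1}` (`A` (D), `S` a simple non-CM surface, `Hom(A, S) = 0`) are stably
nondegenerate. [cite: MoonenZarhin1999LowDim, §3 Thm. (3.2)] [cite: vanGeemen1994HodgeAV, §3.6 (p. 236)] -/
theorem IsStablyNondegenerate.powSucc_prod_simpleSurface_powSucc_of_not_isOfCMType_of_forall_hom_eq_zero
    (hA : IsStablyNondegenerate A) (hS : S.IsSimple) (hS2 : S.dim = 2) (hcm : ¬ IsOfCMType S)
    (hAS : ∀ u : A ⟶ S, u = 0) (a b : ℕ) : IsStablyNondegenerate ((A.powSucc a).prod (S.powSucc b)) :=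
  (hA.prod_simpleSurface_of_not_isOfCMType_of_forall_hom_eq_zero hS hS2 hcm hAS).powSucc_prod_powSucc a b

/-- **THE ROW: for ALL complex abelian varieties `T`, `S` with `0 < dim T ≤ 3`, `S` a simple abelian surface not
of CM type and `Hom(T, S) = 0`, `T × S` is stably nondegenerate** (`T` is (D) by the dimension-`≤ 3` theorem).
[cite: MoonenZarhin1999LowDim, Thm. 0.1 (4), Thm. 0.2 (4), Lemma (3.4) and §5 (5.4)] [cite: vanGeemen1994HodgeAV, Thm. 4.3] -/
theorem isStablyNondegenerate_prod_simpleSurface_of_dim_le_three_of_forall_hom_eq_zero (h0 : 0 < T.dim)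
    (h3 : T.dim ≤ 3) (hS : S.IsSimple) (hS2 : S.dim = 2) (hcm : ¬ IsOfCMType S) (hTS : ∀ u : T ⟶ S, u = 0) :
    IsStablyNondegenerate (T.prod S) :=
  (isStablyNondegenerate_of_dim_pos_of_dim_le_three h0 h3).prod_simpleSurface_of_not_isOfCMType_of_forall_hom_eq_zero
    hS hS2 hcm hTS

/-- **`Y × S` for `0 < dim Y ≤ 2` and `S` a SIMPLE abelian SURFACE NOT of CM type satisfies condition (D)** — NO
`Hom` hypothesis (abelian threefolds `E × S` and the FOURFOLD rows `S' × S` of Moonen–Zarhin Thm. 0.1 (4) — types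
I(1), I(2), II(1) for `S`, any abelian surface `S'` —: the exceptional fourfolds (a)–(d) have no such shape).
CASES: `Y` simple and `Hom(Y, S) = 0` ⟹ the row; `Y` simple and `Hom(Y, S) ≠ 0` ⟹ `Y ∼ S`, `Y × S ∼ S × S`,
powers of `S` (`isStablyNondegenerate_of_isSimple_surface`); `Y` not simple ⟹ `Y ∼ E₁ × E₂` and
`Hom(E₁ × E₂, S) = 0` (`S` simple of dimension `2 ≠ 1`), the row for `(E₁ × E₂) × S`.
[cite: MoonenZarhin1999LowDim, Thm. 0.1 (4), §2 (2.2), Lemma (3.4) and §5 (5.2)]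
[cite: MumfordAV1970, §19 Thm. 1 and Cor. 2 (pp. 173–174)] -/
theorem isStablyNondegenerate_prod_simpleSurface_of_dim_le_two (h0 : 0 < Y.dim) (h2 : Y.dim ≤ 2)
    (hS : S.IsSimple) (hS2 : S.dim = 2) (hcm : ¬ IsOfCMType S) : IsStablyNondegenerate (Y.prod S) := by
  classical
  have hSD : IsStablyNondegenerate S := AbelianVariety.isStablyNondegenerate_of_isSimple_surface S hS hS2
  by_cases hYs : Y.IsSimple
  · by_cases hYS : ∀ u : Y ⟶ S, u = 0
    · exact isStablyNondegenerate_prod_simpleSurface_of_dim_le_three_of_forall_hom_eq_zero h0 (by omega) hS hS2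
        hcm hYS
    · obtain ⟨u, hu⟩ := not_forall.1 hYS
      have hYiso : AbelianVariety.IsIsogenous Y S := ⟨u, isIsogeny_of_isSimple_of_ne_zero hYs hS u hu⟩
      have hSS : IsStablyNondegenerate (S.prod S) := hSD.powSucc 1
      exact hSS.of_isIsogenous (hYiso.prod (AbelianVariety.IsIsogenous.refl S))
  · have hY2 : Y.dim = 2 := by
      by_contra hY2
      exact hYs (isSimple_of_dim_le_one (by omega))
    obtain ⟨E₁, E₂, h₁, h₂, hY⟩ := exists_curve_prod_curve_isIsogenous_of_not_isSimple_surface hY2 hYs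
    have hHom : ∀ u : E₁.prod E₂ ⟶ S, u = 0 :=
      prod_hom_eq_zero_of_forall
        (hom_eq_zero_of_isSimple_of_dim_ne (isSimple_of_dim_le_one h₁.le) hS (by omega))
        (hom_eq_zero_of_isSimple_of_dim_ne (isSimple_of_dim_le_one h₂.le) hS (by omega))
    exact (isStablyNondegenerate_prod_simpleSurface_of_dim_le_three_of_forall_hom_eq_zero (T := E₁.prod E₂)
      (by rw [dim_prod]; omega) (by rw [dim_prod]; omega) hS hS2 hcm hHom).of_isIsogenous'
      (hY.prod (AbelianVariety.IsIsogenous.refl S))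

/-- **`S × S × E'` — the square of a simple non-CM surface `S` times ANY elliptic curve `E'` — satisfies (D)**:
`E'` without complex multiplication ⟹ `Hom(S × S, E') = 0` and the companion's row with the generic CURVE `E'`
as second factor; `E'` of CM type ⟹ the R5 row «no factor of Type IV times a CM curve»
(`hasNoTypeIVFactor_of_isSimple_surface_of_not_isOfCMType`, `HasNoTypeIVFactor.prod`).
[cite: MoonenZarhin1999LowDim, Thm. 0.2 (4), §3 Thm. (3.2)(2), Lemma (3.4) and Prop. (3.8)]
[cite: SilvermanAEC2009, III.9 Cor. 9.4] -/
theorem isStablyNondegenerate_simpleSurface_prod_self_prod_curve {E' : AbelianVariety ℂ} (hS : S.IsSimple)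
    (hS2 : S.dim = 2) (hcm : ¬ IsOfCMType S) (hE'1 : E'.dim = 1) : IsStablyNondegenerate ((S.prod S).prod E') := by
  have hSD : IsStablyNondegenerate S := AbelianVariety.isStablyNondegenerate_of_isSimple_surface S hS hS2
  have hSS : IsStablyNondegenerate (S.prod S) := hSD.powSucc 1
  have hE's : E'.IsSimple := isSimple_of_dim_le_one hE'1.le
  rcases Literature.NumberTheory.ComplexMultiplication.finrank_endAlgebra_eq_one_or_two (A₀ := E') hE'1 with
    h1 | h2
  · -- `E'` without complex multiplication: `Hom(S × S, E') = 0`, the row with `E'` as the generic factor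
    have hHom : ∀ u : S.prod S ⟶ E', u = 0 :=
      prod_hom_eq_zero_of_forall
        (hom_eq_zero_of_isSimple_of_dim_ne hS hE's (by omega))
        (hom_eq_zero_of_isSimple_of_dim_ne hS hE's (by omega))
    exact hSS.prod_lowGeneric_of_forall_hom_eq_zero (by omega) (by omega) h1 hHom
  · -- `E'` of CM type: no factor of Type IV times a CM curve
    have hcm' : IsOfCMType E' :=
      (Literature.NumberTheory.ComplexMultiplication.EllipticCurve.isOfCMType_iff_finrank_end_eq_two hE'1).2
        (by rw [Literature.NumberTheory.ComplexMultiplication.AbelianVariety.finrank_int_end_eq_finrank_endAlgebra]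
            exact h2)
    have hIV : HasNoTypeIVFactor S := hasNoTypeIVFactor_of_isSimple_surface_of_not_isOfCMType hS hS2 hcm
    exact hSS.prod_cmCurve_of_hasNoTypeIVFactor (hIV.prod hIV) hE'1 hcm'

/-- **THE FIVEFOLD THEOREM: `T × S` for EVERY abelian threefold `T` and every SIMPLE abelian SURFACE `S` NOT of
CM type satisfies condition (D)** — NO `Hom` hypothesis (Moonen–Zarhin Thm. 0.2 (4): the exceptional fivefolds
(e)–(g) have no isogeny factor `S` of this kind with cofactor a threefold). CASES (Poincaré): `T` simple ⟹
`Hom(T, S) = 0`, the row; `T ∼ E' × S''` with `S''` not simple ⟹ `T ∼ E' × E₁ × E₂`, `Hom = 0`, the row; `S''`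
simple with `Hom(S'', S) = 0` ⟹ `Hom(E' × S'', S) = 0`, the row; `S''` simple with `Hom(S'', S) ≠ 0` ⟹
`S'' ∼ S`, `T × S ∼ S × S × E'` (`isStablyNondegenerate_simpleSurface_prod_self_prod_curve`).
[cite: MoonenZarhin1999LowDim, Thm. 0.2 (4), §2 (2.2), Lemma (3.4), Prop. (3.8) and §5 (5.2)]
[cite: MumfordAV1970, §19 Thm. 1 and Cor. 2 (pp. 173–174)] -/
theorem isStablyNondegenerate_threefold_prod_simpleSurface (hT3 : T.dim = 3) (hS : S.IsSimple) (hS2 : S.dim = 2)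
    (hcm : ¬ IsOfCMType S) : IsStablyNondegenerate (T.prod S) := by
  classical
  by_cases hTs : T.IsSimple
  · exact isStablyNondegenerate_prod_simpleSurface_of_dim_le_three_of_forall_hom_eq_zero (by omega) hT3.le hS hS2
      hcm (hom_eq_zero_of_isSimple_of_dim_ne hTs hS (by omega))
  obtain ⟨E', S'', hE'1, hS''2, hT⟩ := exists_curve_prod_surface_isIsogenous_of_not_isSimple_threefold hT3 hTs
  have hX : AbelianVariety.IsIsogenous ((E'.prod S'').prod S) (T.prod S) := hT.prod (AbelianVariety.IsIsogenous.refl S)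
  have hE'0 : ∀ f : E' ⟶ S, f = 0 :=
    hom_eq_zero_of_isSimple_of_dim_ne (isSimple_of_dim_le_one hE'1.le) hS (by omega)
  by_cases hS''s : S''.IsSimple
  · by_cases hS''S : ∀ g : S'' ⟶ S, g = 0
    · -- `Hom(E' × S'', S) = 0`: the row for the threefold `E' × S''`
      exact (isStablyNondegenerate_prod_simpleSurface_of_dim_le_three_of_forall_hom_eq_zero (T := E'.prod S'')
        (by rw [dim_prod]; omega) (by rw [dim_prod]; omega) hS hS2 hcm
        (prod_hom_eq_zero_of_forall hE'0 hS''S)).of_isIsogenous' hX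
    · -- `S'' ∼ S`: `T × S ∼ (E' × S) × S ∼ S × (E' × S) ∼ S × (S × E') ∼ (S × S) × E'`
      obtain ⟨g, hg⟩ := not_forall.1 hS''S
      have hS''iso : AbelianVariety.IsIsogenous S'' S := ⟨g, isIsogeny_of_isSimple_of_ne_zero hS''s hS g hg⟩
      have h1 : AbelianVariety.IsIsogenous ((E'.prod S'').prod S) ((E'.prod S).prod S) :=
        ((AbelianVariety.IsIsogenous.refl E').prod hS''iso).prod (AbelianVariety.IsIsogenous.refl S)
      have h2 : AbelianVariety.IsIsogenous ((E'.prod S).prod S) (S.prod (E'.prod S)) := isIsogenous_prodRotate E' S S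
      have hc : AbelianVariety.IsIsogenous (E'.prod S) (S.prod E') :=
        (AbelianVariety.IsIsogenous.trans ⟨(biprodIsoProd E' S).inv, isIsogeny_hom_of_iso (biprodIsoProd E' S).symm⟩
          (isIsogenous_biprod_comm E' S)).trans ⟨(biprodIsoProd S E').hom, isIsogeny_hom_of_iso (biprodIsoProd S E')⟩
      have h3 : AbelianVariety.IsIsogenous (S.prod (E'.prod S)) (S.prod (S.prod E')) :=
        (AbelianVariety.IsIsogenous.refl S).prod hc
      have hD : IsStablyNondegenerate (S.prod (S.prod E')) :=
        (isStablyNondegenerate_simpleSurface_prod_self_prod_curve hS hS2 hcm hE'1).of_isIsogenous'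
          (isIsogenous_prodRotate S S E')
      exact (((hD.of_isIsogenous h3).of_isIsogenous h2).of_isIsogenous h1).of_isIsogenous' hX
  · -- `S'' ∼ E₁ × E₂`: `T ∼ E' × (E₁ × E₂)`, `Hom(·, S) = 0`
    obtain ⟨E₁, E₂, h₁, h₂, hS''⟩ := exists_curve_prod_curve_isIsogenous_of_not_isSimple_surface hS''2 hS''s
    have hHom : ∀ u : E'.prod (E₁.prod E₂) ⟶ S, u = 0 :=
      prod_hom_eq_zero_of_forall hE'0 (prod_hom_eq_zero_of_forall
        (hom_eq_zero_of_isSimple_of_dim_ne (isSimple_of_dim_le_one h₁.le) hS (by omega))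
        (hom_eq_zero_of_isSimple_of_dim_ne (isSimple_of_dim_le_one h₂.le) hS (by omega)))
    have hiso : AbelianVariety.IsIsogenous ((E'.prod (E₁.prod E₂)).prod S) ((E'.prod S'').prod S) :=
      ((AbelianVariety.IsIsogenous.refl E').prod hS'').prod (AbelianVariety.IsIsogenous.refl S)
    exact ((isStablyNondegenerate_prod_simpleSurface_of_dim_le_three_of_forall_hom_eq_zero (T := E'.prod (E₁.prod E₂))
      (by rw [dim_prod, dim_prod]; omega) (by rw [dim_prod, dim_prod]; omega) hS hS2 hcm hHom).of_isIsogenous'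
      hiso).of_isIsogenous' hX

/-- **Summary: `Y × S` satisfies (D) for EVERY `Y` with `0 < dim Y ≤ 3` and every simple abelian surface `S` not of
CM type** (abelian varieties of dimension `3 ≤ dim ≤ 5` with such a factor; Thm. 0.1 (4), Thm. 0.2 (4)).
[cite: MoonenZarhin1999LowDim, Thm. 0.1 (4), Thm. 0.2 (4), §2 (2.2) and Lemma (3.4)] -/
theorem isStablyNondegenerate_prod_simpleSurface_of_dim_le_three (h0 : 0 < Y.dim) (h3 : Y.dim ≤ 3)
    (hS : S.IsSimple) (hS2 : S.dim = 2) (hcm : ¬ IsOfCMType S) : IsStablyNondegenerate (Y.prod S) := by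
  rcases Nat.lt_or_ge Y.dim 3 with hY | hY
  · exact isStablyNondegenerate_prod_simpleSurface_of_dim_le_two h0 (by omega) hS hS2 hcm
  · exact isStablyNondegenerate_threefold_prod_simpleSurface (by omega) hS hS2 hcm

/-- The same products in the other order: `S × Y`. [cite: MoonenZarhin1999LowDim, Thm. 0.1 (4) and Thm. 0.2 (4)] -/
theorem isStablyNondegenerate_simpleSurface_prod_of_dim_le_three (hS : S.IsSimple) (hS2 : S.dim = 2)
    (hcm : ¬ IsOfCMType S) (h0 : 0 < Y.dim) (h3 : Y.dim ≤ 3) : IsStablyNondegenerate (S.prod Y) :=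
  (isStablyNondegenerate_prod_simpleSurface_of_dim_le_three h0 h3 hS hS2 hcm).of_isIsogenous
    ((AbelianVariety.IsIsogenous.trans ⟨(biprodIsoProd S Y).inv, isIsogeny_hom_of_iso (biprodIsoProd S Y).symm⟩
      (isIsogenous_biprod_comm S Y)).trans ⟨(biprodIsoProd Y S).hom, isIsogeny_hom_of_iso (biprodIsoProd Y S)⟩)

/-- **The FOURFOLDS `S' × S` of two abelian surfaces, one of which is simple and not of CM type, satisfy (D)**
(Moonen–Zarhin Thm. 0.1 (4): rows I(1)/I(2)/II(1) × anything of dimension `2`).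
[cite: MoonenZarhin1999LowDim, Thm. 0.1 (4), §2 (2.2) and §5 (5.2), (5.4)] -/
theorem isStablyNondegenerate_surface_prod_surface_of_isSimple_of_not_isOfCMType {S' : AbelianVariety ℂ}
    (hS'2 : S'.dim = 2) (hS2 : S.dim = 2)
    (h : (S'.IsSimple ∧ ¬ IsOfCMType S') ∨ (S.IsSimple ∧ ¬ IsOfCMType S)) : IsStablyNondegenerate (S'.prod S) := by
  rcases h with ⟨hs, hcm⟩ | ⟨hs, hcm⟩
  · exact isStablyNondegenerate_simpleSurface_prod_of_dim_le_three hs hS'2 hcm (by omega) (by omega)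
  · exact isStablyNondegenerate_prod_simpleSurface_of_dim_le_three (by omega) (by omega) hs hS2 hcm

/-- **Everything isogenous to such a `Y × S` is stably nondegenerate.**
[cite: MoonenZarhin1999LowDim, Thm. 0.1 (4) and Thm. 0.2 (4)] [cite: vanGeemen1994HodgeAV, §3.6 (p. 236)] -/
theorem isStablyNondegenerate_of_isIsogenous_prod_simpleSurface_of_dim_le_three (h0 : 0 < Y.dim) (h3 : Y.dim ≤ 3)
    (hS : S.IsSimple) (hS2 : S.dim = 2) (hcm : ¬ IsOfCMType S) {X : AbelianVariety ℂ}
    (hX : AbelianVariety.IsIsogenous X (Y.prod S)) : IsStablyNondegenerate X :=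
  (isStablyNondegenerate_prod_simpleSurface_of_dim_le_three h0 h3 hS hS2 hcm).of_isIsogenous hX

/-- **The Hodge conjecture for every power of every abelian variety isogenous to `Y × S`** (`0 < dim Y ≤ 3`, `S`
a simple abelian surface not of CM type) — UNCONDITIONALLY (no HC_CM).
[cite: MoonenZarhin1999LowDim, Thm. 0.1 (4) and Thm. 0.2 (4)] [cite: vanGeemen1994HodgeAV, §2.4 and Lemma 3.7] -/
theorem hodgeConjectureFor_powSucc_of_isIsogenous_prod_simpleSurface_of_dim_le_three (h0 : 0 < Y.dim)
    (h3 : Y.dim ≤ 3) (hS : S.IsSimple) (hS2 : S.dim = 2) (hcm : ¬ IsOfCMType S) {X : AbelianVariety ℂ}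
    (hX : AbelianVariety.IsIsogenous X (Y.prod S)) (N : ℕ) :
    HodgeConjectureFor (X.powSucc N).dim (X.powSucc N).X :=
  (isStablyNondegenerate_of_isIsogenous_prod_simpleSurface_of_dim_le_three h0 h3 hS hS2 hcm hX).hodgeConjectureFor_powSucc N

/-- **The Hodge conjecture for every abelian variety isogenous to `Y × S`** (`0 < dim Y ≤ 3`, `S` a simple
abelian surface not of CM type). [cite: MoonenZarhin1999LowDim, Thm. 0.1 (4) and Thm. 0.2 (4)] -/
theorem hodgeConjectureFor_of_isIsogenous_prod_simpleSurface_of_dim_le_three (h0 : 0 < Y.dim) (h3 : Y.dim ≤ 3)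
    (hS : S.IsSimple) (hS2 : S.dim = 2) (hcm : ¬ IsOfCMType S) {X : AbelianVariety ℂ}
    (hX : AbelianVariety.IsIsogenous X (Y.prod S)) : HodgeConjectureFor X.dim X.X :=
  (isStablyNondegenerate_of_isIsogenous_prod_simpleSurface_of_dim_le_three h0 h3 hS hS2 hcm hX).hodgeConjectureFor

/-- **The Hodge conjecture for `Y × S` itself** (e.g. the FOURFOLDS `S' × S` with `S` of type I(2) or II(1)).
[cite: MoonenZarhin1999LowDim, Thm. 0.1 (4), Thm. 0.2 (4) and Lemma (3.4)] -/
theorem hodgeConjectureFor_prod_simpleSurface_of_dim_le_three (h0 : 0 < Y.dim) (h3 : Y.dim ≤ 3)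
    (hS : S.IsSimple) (hS2 : S.dim = 2) (hcm : ¬ IsOfCMType S) : HodgeConjectureFor (Y.prod S).dim (Y.prod S).X :=
  (isStablyNondegenerate_prod_simpleSurface_of_dim_le_three h0 h3 hS hS2 hcm).hodgeConjectureFor

end Surfaces

end Literature.AlgebraicGeometry.HodgeTheory

end
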